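import Summits.Ventures.HodgeRepro2.T5IsotypicPi

/-!
# T5IsotypicComponentBound — «dim π₀^{K_f}[τ] ≤ m_{K_f}(π_∞) · dim (H_{π_∞})_τ», algebraic form,
with only `H[τ]` finite-dimensional

Cell pub-hodge-repro2, seat p5, Tier 5 (route/T5-N4-p5.md, N4.3 v13 (A3) STEP 5, l. 147: «Therefore
π₀^{K_f}[τ] ⊂ (L_{π_∞} ∩ L^{K_f})[τ] = (m_{K_f}(π_∞) H_{π_∞})[τ] and dim π₀^{K_f}[τ] ≤ m_{K_f}(π_∞) ·
dim (H_{π_∞})_τ < ∞ — the first factor finite by STEP 2, the second by (A2) applied to the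
irreducible unitary G_∞-representation π_∞»).  Row 25 (`T5IsotypicPi.finrank_isotypicComponent_pi`)
counts `dim_k (ι → H)[T] = #ι · dim_k H[T]` under the hypothesis that `H` itself is
finite-dimensional; admissibility ([KV] Thm 0.3) gives only that the `τ`-isotypic part `H[τ]` is
finite-dimensional.  This file removes the extra hypothesis and adds the transport along
`R`-linear equivalences and the monotonicity in the submodule (row 78 supplies the equivalence
`L_{π_∞} ∩ L^{K_f} ≃ₗ[ℂ[K_∞]] (S_π → H_{π_∞})`; this row was announced by gen 11 at STATUS
l. 12024 as «row 77» and re-derived here by gen 12 under a new module name — see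
route/LEAN-ANNEX-p5.md §18).  For a `k`-algebra `R` and a simple `R`-module `T` (the `K_∞`-type
`τ`):

* `map_isotypicComponent_equiv`, `isotypicComponentEquiv`: an `R`-linear equivalence carries the
  `T`-isotypic component onto the `T`-isotypic component (Mathlib's
  `LinearMap.le_comap_isotypicComponent` in both directions);
* `finrank_isotypicComponent_eq_of_equiv`, `finite_isotypicComponent_of_equiv`: hence equal
  `k`-dimensions / finiteness transported;
* `finrank_isotypicComponent_pi_of_finite`: `dim_k (ι → H)[T] = #ι · dim_k H[T]` whenever `H[T]` is
  finite-dimensional (`H` itself not assumed finite-dimensional) — row 25's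
  `isotypicComponentPiEquiv` + `Module.finrank_pi_fintype`;
* `isotypicComponentInclusion`, `finite_isotypicComponent_of_le`,
  `finrank_isotypicComponent_le_of_le`: the `T`-isotypic component of an `R`-submodule `W ≤ M`
  injects `k`-linearly into that of `M`;
* **`finrank_isotypicComponent_le_of_equiv_pi`**: `M ≃ₗ[R] (ι → H)`, `H[T]` finite-dimensional ⇒ for
  EVERY `R`-submodule `W ≤ M`, `W[T]` is finite-dimensional with
  `dim_k W[T] ≤ #ι · dim_k H[T]` — STEP 5's displayed inequality.

Imports row 25 and Mathlib.  Axioms: propext, Classical.choice, Quot.sound.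
README §8(d): uses an L-value-free non-vanishing device: NO.
-/

namespace Summit.Ventures.HodgeRepro2.T5IsotypicComponentBound

open Summit.Ventures.HodgeRepro2.T5IsotypicPi (isotypicComponentPiEquiv)

section Transport

variable {R : Type*} [Ring R] {M N : Type*} [AddCommGroup M] [Module R M] [AddCommGroup N]
  [Module R N] (T : Type*) [AddCommGroup T] [Module R T] [IsSimpleModule R T]

/-- An `R`-linear equivalence maps the `T`-isotypic component ONTO the `T`-isotypic component. -/
theorem map_isotypicComponent_equiv (e : M ≃ₗ[R] N) :
    (isotypicComponent R M T).map (e : M →ₗ[R] N) = isotypicComponent R N T := by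
  apply le_antisymm
  · rw [Submodule.map_le_iff_le_comap]
    exact LinearMap.le_comap_isotypicComponent T (e : M →ₗ[R] N)
  · intro y hy
    have h := LinearMap.le_comap_isotypicComponent T (e.symm : N →ₗ[R] M) hy
    rw [Submodule.mem_comap] at h
    exact ⟨e.symm y, h, by simp⟩

/-- The induced `R`-linear equivalence of `T`-isotypic components. -/
noncomputable def isotypicComponentEquiv (e : M ≃ₗ[R] N) :
    isotypicComponent R M T ≃ₗ[R] isotypicComponent R N T :=
  (LinearEquiv.submoduleMap e (isotypicComponent R M T)).trans
    (LinearEquiv.ofEq _ _ (map_isotypicComponent_equiv T e))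

/-- `isotypicComponentEquiv T e x = e x`. -/
@[simp] theorem coe_isotypicComponentEquiv_apply (e : M ≃ₗ[R] N) (x : isotypicComponent R M T) :
    (isotypicComponentEquiv T e x : N) = e x := rfl

end Transport

section Dimension

variable {k R : Type*} [Field k] [Ring R] [Algebra k R]
variable {M N : Type*} [AddCommGroup M] [Module R M] [Module k M] [IsScalarTower k R M]
  [AddCommGroup N] [Module R N] [Module k N] [IsScalarTower k R N]
variable (T : Type*) [AddCommGroup T] [Module R T] [IsSimpleModule R T]

/-- Equivalent `R`-modules have `T`-isotypic components of the same `k`-dimension. -/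
theorem finrank_isotypicComponent_eq_of_equiv (e : M ≃ₗ[R] N) :
    Module.finrank k (isotypicComponent R M T) = Module.finrank k (isotypicComponent R N T) :=
  ((isotypicComponentEquiv T e).restrictScalars k).finrank_eq

/-- Finite-dimensionality of the `T`-isotypic component transports along `R`-linear
equivalences. -/
theorem finite_isotypicComponent_of_equiv (e : M ≃ₗ[R] N)
    [Module.Finite k (isotypicComponent R M T)] : Module.Finite k (isotypicComponent R N T) :=
  Module.Finite.equiv ((isotypicComponentEquiv T e).restrictScalars k)

variable {H : Type*} [AddCommGroup H] [Module R H] [Module k H] [IsScalarTower k R H]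

/-- The `T`-isotypic component of `ι → H` is finite-dimensional as soon as `H[T]` is. -/
theorem finite_isotypicComponent_pi {ι : Type*} [Fintype ι] [DecidableEq ι]
    [Module.Finite k (isotypicComponent R H T)] :
    Module.Finite k (isotypicComponent R (ι → H) T) :=
  Module.Finite.equiv ((isotypicComponentPiEquiv T).restrictScalars k).symm

/-- **`dim_k (ι → H)[T] = #ι · dim_k H[T]`**, assuming only that `H[T]` is finite-dimensional (row 25's
`finrank_isotypicComponent_pi` assumed `H` itself finite-dimensional). -/
theorem finrank_isotypicComponent_pi_of_finite {ι : Type*} [Fintype ι] [DecidableEq ι]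
    [Module.Finite k (isotypicComponent R H T)] :
    Module.finrank k (isotypicComponent R (ι → H) T) =
      Fintype.card ι * Module.finrank k (isotypicComponent R H T) := by
  rw [((isotypicComponentPiEquiv T).restrictScalars k).finrank_eq, Module.finrank_pi_fintype,
    Finset.sum_const, Finset.card_univ, smul_eq_mul]

/-- The `T`-isotypic component of an `R`-submodule `W ≤ M` sits inside that of `M`. -/
theorem map_subtype_isotypicComponent_le (W : Submodule R M) :
    (isotypicComponent R W T).map W.subtype ≤ isotypicComponent R M T := by
  rw [Submodule.map_le_iff_le_comap]
  exact LinearMap.le_comap_isotypicComponent T W.subtype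

variable (k) in
/-- The `k`-linear inclusion `W[T] → M[T]`. -/
def isotypicComponentInclusion (W : Submodule R M) :
    isotypicComponent R W T →ₗ[k] isotypicComponent R M T where
  toFun x := ⟨((x : isotypicComponent R W T) : W),
    map_subtype_isotypicComponent_le T W (Submodule.mem_map.mpr ⟨x, x.2, rfl⟩)⟩
  map_add' _ _ := rfl
  map_smul' _ _ := rfl

/-- `isotypicComponentInclusion k T W x = x`, as elements of `M`. -/
@[simp] theorem coe_isotypicComponentInclusion_apply (W : Submodule R M)
    (x : isotypicComponent R W T) :
    ((isotypicComponentInclusion k T W x : isotypicComponent R M T) : M) = (x : W) :=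
  rfl

/-- The inclusion `W[T] → M[T]` is injective. -/
theorem isotypicComponentInclusion_injective (W : Submodule R M) :
    Function.Injective (isotypicComponentInclusion k T W) := by
  intro x y hxy
  apply Subtype.ext
  apply Subtype.ext
  have h := congrArg (fun z : isotypicComponent R M T => (z : M)) hxy
  simpa only [coe_isotypicComponentInclusion_apply] using h

/-- `W[T]` is finite-dimensional whenever `M[T]` is. -/
theorem finite_isotypicComponent_of_le (W : Submodule R M)
    [Module.Finite k (isotypicComponent R M T)] : Module.Finite k (isotypicComponent R W T) :=
  Module.Finite.of_injective (isotypicComponentInclusion k T W)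
    (isotypicComponentInclusion_injective (k := k) T W)

/-- `dim_k W[T] ≤ dim_k M[T]` for an `R`-submodule `W ≤ M` with `M[T]` finite-dimensional. -/
theorem finrank_isotypicComponent_le_of_le (W : Submodule R M)
    [Module.Finite k (isotypicComponent R M T)] :
    Module.finrank k (isotypicComponent R W T) ≤ Module.finrank k (isotypicComponent R M T) :=
  LinearMap.finrank_le_finrank_of_injective (isotypicComponentInclusion_injective (k := k) T W)

/-- **STEP 5's dimension bound, algebraic form.**  If `M ≃ₗ[R] (ι → H)` with `ι` finite and `H[T]`
finite-dimensional over `k`, then for EVERY `R`-submodule `W ≤ M` the `T`-isotypic component `W[T]` is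
finite-dimensional and `dim_k W[T] ≤ #ι · dim_k H[T]` — «dim π₀^{K_f}[τ] ≤ m_{K_f}(π_∞) ·
dim (H_{π_∞})_τ» with `M := L_{π_∞} ∩ L^{K_f} ≅ m copies of H_{π_∞}` (rows 76 / 78) and
`W := π₀^{K_f}`. -/
theorem finrank_isotypicComponent_le_of_equiv_pi {ι : Type*} [Fintype ι] [DecidableEq ι]
    (e : M ≃ₗ[R] (ι → H)) [Module.Finite k (isotypicComponent R H T)] (W : Submodule R M) :
    Module.Finite k (isotypicComponent R W T) ∧
      Module.finrank k (isotypicComponent R W T) ≤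
        Fintype.card ι * Module.finrank k (isotypicComponent R H T) := by
  haveI : Module.Finite k (isotypicComponent R (ι → H) T) := finite_isotypicComponent_pi T
  haveI : Module.Finite k (isotypicComponent R M T) := finite_isotypicComponent_of_equiv T e.symm
  refine ⟨finite_isotypicComponent_of_le T W, ?_⟩
  calc Module.finrank k (isotypicComponent R W T)
      ≤ Module.finrank k (isotypicComponent R M T) := finrank_isotypicComponent_le_of_le T W
    _ = Module.finrank k (isotypicComponent R (ι → H) T) :=
        finrank_isotypicComponent_eq_of_equiv T e
    _ = Fintype.card ι * Module.finrank k (isotypicComponent R H T) :=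
        finrank_isotypicComponent_pi_of_finite T

end Dimension

end Summit.Ventures.HodgeRepro2.T5IsotypicComponentBound
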